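import Literature.AnabelianGeometry.SemiGraphs.PSCCoveringMapAlongProofs
import Literature.AnabelianGeometry.SemiGraphs.ProSigmaCompletionRestrict
import Literature.AnabelianGeometry.SemiGraphs.ProSigmaSubquotients
import HarnessLib

/-!
# Pro-`Σ` completions of discrete groups, IV: composing with the maximal pro-`Σ` quotient

[SemiAnbd] Example 2.10 (p. 31: "the maximal pro-`Σ` quotient of the fundamental group of a hyperbolic
Riemann surface of finite type") is typed as the interface `SemiGraphOfAnabelioids.IsProSigmaCompletion Σ ι`
(`Coverticial.lean`), and [CombGC] Thm. 1.6 (i) p. 13 ("we may assume that `Σ = {l}`", the maximal pro-`l`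
quotient) as `PSCDatum.IsMaxProSigmaQuotient S f` (`PSCCoveringMapAlong.lean`): `f : Π ↠ Q` continuous onto a
pro-`S` group with kernel below every open normal `S`-index subgroup.  [AbsTopI] Def 2.1 (i) p. 17 combines
the two ("`Ker(Δ_X → Gal(Y/X))` may be identified with the maximal pro-`Σ` quotient of
`Ker(π₁(X_k̄) → Gal(Y/X))`").  This PROOF-ONLY file (no definition, no named fact) supplies the plumbing:

* `comp_isMaxProSigmaQuotient` — **a pro-`Σ′` completion `ι : Γ → P` followed by a presentation
  `f : P ↠ Q` of the maximal pro-`Σ` quotient (`Σ ⊆ Σ′`) is a pro-`Σ` completion `f ∘ ι : Γ → Q`**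
  (dense image; `Q` pro-`Σ`; a normal `Σ`-index `N ⊴ Γ` is `ι⁻¹U` for an open `U`, normal of `Σ`-index by
  density, so `ker f ≤ U` and `N = (f ∘ ι)⁻¹ f(U)`);
* `ker_le_ker_of_isMaxProSigmaQuotient` — the kernel of such a presentation lies in the kernel of EVERY
  continuous homomorphism to a profinite pro-`Σ` group (maximality, in the form used downstream);
* `map_eq_one_of_isMaxProSigmaQuotient_of_le` — for `U ≤ U′` subgroups of a profinite group with `U` open and
  presentations `f_U`, `f_{U′}` of their maximal pro-`Σ` quotients: `K_Σ(U) ⊆ K_Σ(U′)`.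

Consumer: the GFG surface model of [AbsTopI] Prop 2.3 (i) (`AbsTopIProp23iGFGSurfaceModel.lean`, abc-iut
L4 «P23i-FN-ORIGIN-GFG-MODEL»).  Plain profinite group theory; nothing here bears on [IUTchIII] Cor. 3.12.
-/

noncomputable section

namespace Literature.AnabelianGeometry.SemiGraphs.SemiGraphOfAnabelioids.IsProSigmaCompletion

open Literature.AnabelianGeometry.Anabelioids Topology
open Literature.AnabelianGeometry.SemiGraphs.PSCDatum (IsMaxProSigmaQuotient)

universe u

variable {Sigma Sigma' : Set ℕ} {Γ : Type*} [Group Γ] {P : Type u} [Group P] [TopologicalSpace P]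
  [IsTopologicalGroup P] [CompactSpace P]
  {Q : Type u} [Group Q] [TopologicalSpace Q] [IsTopologicalGroup Q] [CompactSpace Q] [T2Space Q]
  {ι : Γ →* P} {f : P →* Q}

/-! ### An open normal subgroup of a compact pro-`Σ` group has `Σ`-integer index -/

omit [T2Space Q] in
/-- In a compact pro-`Σ` group, an open normal subgroup has `Σ`-integer index.
[cite: MochizukiCombGC2007, Def 1.1(ii) p.6] -/
theorem isSigmaInteger_index_of_isProSigma_of_normal (hQ : IsProSigma Sigma Q) (N : Subgroup Q)
    [hN : N.Normal] (hNo : IsOpen (N : Set Q)) : IsSigmaInteger Sigma N.index := by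
  haveI : Finite (Q ⧸ N) := Subgroup.quotient_finite_of_isOpen N hNo
  haveI : N.FiniteIndex := Subgroup.finiteIndex_of_finite_quotient
  let N' : OpenNormalSubgroup Q := { toSubgroup := N, isOpen' := hNo, isNormal' := hN }
  refine ⟨Nat.pos_of_ne_zero Subgroup.FiniteIndex.index_ne_zero, fun p hp hpd => ?_⟩
  exact hQ.prime_mem N' (inferInstanceAs (Finite (Q ⧸ N))) p hp (by rwa [← Subgroup.index_eq_card])

/-! ### Composition with a presentation of the maximal pro-`Σ` quotient -/

omit [CompactSpace Q] [T2Space Q] in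
/-- For a presentation `f : P ↠ Q` of the maximal pro-`Σ` quotient and an open normal subgroup `U ⊴ P` of
`Σ`-integer index: `ker f ≤ U`, the image `f(U)` is an open normal subgroup of `Q`, and `f⁻¹ f(U) = U`.
[cite: MochizukiCombGC2007, Thm 1.6(i) p.13] -/
theorem isOpen_map_of_isMaxProSigmaQuotient [T2Space Q] (hf : IsMaxProSigmaQuotient Sigma f)
    (U : Subgroup P) [U.Normal] (hUo : IsOpen (U : Set P)) (hUS : IsSigmaInteger Sigma U.index) :
    IsOpen ((U.map f : Subgroup Q) : Set Q) ∧ (U.map f).comap f = U := by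
  have hker : f.ker ≤ U := hf.ker_le U inferInstance hUo hUS
  have hcomap : (U.map f).comap f = U := Subgroup.comap_map_eq_self hker
  refine ⟨?_, hcomap⟩
  -- closed (image of a compact set) and of finite index, hence open
  have hclosed : IsClosed ((U.map f : Subgroup Q) : Set Q) := by
    have : ((U.map f : Subgroup Q) : Set Q) = f '' (U : Set P) := Subgroup.coe_map f U
    rw [this]
    exact ((U.isClosed_of_isOpen hUo).isCompact.image hf.continuous).isClosed
  have hidx : (U.map f).index = U.index := by
    rw [← Subgroup.index_comap_of_surjective (U.map f) hf.surjective, hcomap]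
  haveI : (U.map f).FiniteIndex := ⟨by rw [hidx]; exact hUS.1.ne'⟩
  exact Subgroup.isOpen_of_isClosed_of_finiteIndex _ hclosed

/-- **A pro-`Σ′` completion followed by the maximal pro-`Σ` quotient is a pro-`Σ` completion** (`Σ ⊆ Σ′`):
for `ι : Γ → P` exhibiting the profinite `P` as the pro-`Σ′` completion of `Γ` and `f : P ↠ Q` a presentation
of the maximal pro-`Σ` quotient of `P`, the composite `f ∘ ι : Γ → Q` exhibits `Q` as the pro-`Σ` completion
of `Γ`.  ([AbsTopI] Def 2.1 (i): "`Ker(Δ_X → Gal(Y/X))` may be identified with the maximal pro-`Σ` quotient of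
`Ker(π₁^{tame}(X_k̄) → Gal(Y/X))`" — so it is the pro-`Σ` completion of the discrete `π₁(Y)`.)
[cite: MochizukiAbsTopI2012, Def 2.1 (i) p.17] -/
theorem comp_isMaxProSigmaQuotient [TotallyDisconnectedSpace P] (hSS : Sigma ⊆ Sigma') (hι : IsProSigmaCompletion Sigma' ι)
    (hf : IsMaxProSigmaQuotient Sigma f) : IsProSigmaCompletion Sigma (f.comp ι) where
  dense := by
    have h : DenseRange (f ∘ ι) := hf.surjective.denseRange.comp hι.dense hf.continuous
    rw [MonoidHom.coe_comp]
    exact h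
  index_open N hNn hNo := by
    haveI := hNn
    exact isSigmaInteger_index_of_isProSigma_of_normal hf.proSigma N hNo
  comap_surj N hNn hNS := by
    haveI := hNn
    -- `N` has `Σ′`-integer index, so it is `ι⁻¹ U` for an open `U`, normal of `Σ`-integer index
    have hNS' : IsSigmaInteger Sigma' N.index := ⟨hNS.1, fun p hp hpd => hSS (hNS.2 p hp hpd)⟩
    obtain ⟨U, hUo, hUN⟩ := hι.comap_surj N hNn hNS'
    haveI hUn : U.Normal := normal_of_comap_normal hι U hUo (by rw [hUN]; exact hNn)
    have hUidx : IsSigmaInteger Sigma U.index := by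
      rw [← index_comap_of_normal hι U hUo, hUN]; exact hNS
    obtain ⟨hopen, hcomap⟩ := isOpen_map_of_isMaxProSigmaQuotient hf U hUo hUidx
    refine ⟨U.map f, hopen, ?_⟩
    rw [← Subgroup.comap_comap, hcomap, hUN]

/-! ### Maximality: the kernel dies in every continuous homomorphism to a profinite pro-`Σ` group -/

omit [CompactSpace P] [IsTopologicalGroup P] [IsTopologicalGroup Q] [CompactSpace Q] [T2Space Q] in
/-- **Maximality of the maximal pro-`Σ` quotient.**  If `f : P ↠ Q` presents the maximal pro-`Σ` quotient of
`P` and `φ : P → R` is a continuous homomorphism to a profinite pro-`Σ` group `R`, then `ker f ≤ ker φ`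
(`φ` factors through `f`): for every open normal `V ⊴ R`, `φ⁻¹V` is open normal of index dividing `[R : V]`,
a `Σ`-integer, so `ker f ≤ φ⁻¹ V`; and the open normal subgroups of `R` meet in `1`.
[cite: MochizukiCombGC2007, Thm 1.6(i) p.13] -/
theorem ker_le_ker_of_isMaxProSigmaQuotient {R : Type*} [Group R] [TopologicalSpace R]
    [IsTopologicalGroup R] [CompactSpace R] [TotallyDisconnectedSpace R]
    (hf : IsMaxProSigmaQuotient Sigma f) (hR : IsProSigma Sigma R) (φ : P →* R) (hφ : Continuous φ) :
    f.ker ≤ φ.ker := by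
  intro k hk
  rw [MonoidHom.mem_ker]
  by_contra hne
  obtain ⟨V, hV⟩ := ProfiniteGrp.exist_openNormalSubgroup_sub_open_nhds_of_one
    (isOpen_compl_singleton (x := φ k)) (by simpa using (Ne.symm hne))
  have hφk : φ k ∉ (V : Set R) := fun hm => hV hm rfl
  -- `φ⁻¹ V` is open, normal, of `Σ`-integer index
  haveI : V.toSubgroup.Normal := V.isNormal'
  have hidxV : IsSigmaInteger Sigma V.toSubgroup.index :=
    isSigmaInteger_index_of_isProSigma_of_normal hR V.toSubgroup V.isOpen'
  have hidx : IsSigmaInteger Sigma (V.toSubgroup.comap φ).index := by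
    refine hidxV.of_dvd ?_
    rw [Subgroup.index_comap V.toSubgroup φ]
    exact Subgroup.relIndex_dvd_index_of_normal V.toSubgroup φ.range
  have hle := hf.ker_le (V.toSubgroup.comap φ) inferInstance (V.isOpen'.preimage hφ) hidx
  exact hφk (hle hk)

/-! ### Monotonicity of `K_Σ` along an inclusion of subgroups -/

omit [IsTopologicalGroup P] [CompactSpace P] [IsTopologicalGroup Q] [CompactSpace Q] [T2Space Q] in
/-- **`K_Σ(U) ⊆ K_Σ(U′)` for `U ≤ U′`.**  Let `U ≤ U′` be subgroups of a topological group `P` with `U` OPEN,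
and let `f_U : U ↠ Q`, `f_{U′} : U′ ↠ Q′` present the maximal pro-`Σ` quotients (`Q′` profinite).  Then every
`u ∈ U` killed by `f_U` is killed by `f_{U′}`: an open normal `Σ`-index `N″ ⊴ U′` meets `U` in an open normal
subgroup of `U` whose index divides `[U′ : N″]`. [cite: MochizukiCombGC2007, Thm 1.6(i) p.13] -/
theorem map_eq_one_of_isMaxProSigmaQuotient_of_le {Q' : Type u} [Group Q'] [TopologicalSpace Q']
    [IsTopologicalGroup Q'] [CompactSpace Q'] [TotallyDisconnectedSpace Q']
    {U U' : Subgroup P} (hUU' : U ≤ U') {fU : U →* Q} {fU' : U' →* Q'}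
    (hU : IsMaxProSigmaQuotient Sigma fU) (hU' : IsMaxProSigmaQuotient Sigma fU')
    {u : P} (hu : u ∈ U) (h : fU ⟨u, hu⟩ = 1) : fU' ⟨u, hUU' hu⟩ = 1 := by
  have hmem : (⟨u, hUU' hu⟩ : U') ∈ fU'.ker := by
    rw [hU'.ker_eq_iInf]
    refine Subgroup.mem_iInf.mpr fun N'' => ?_
    obtain ⟨hNn, hNo, hNS⟩ := N''.2
    -- the trace of `N″` on `U`, as a subgroup of `U`
    let N : Subgroup U := (N''.1).comap (Subgroup.inclusion hUU')
    have hNo' : IsOpen (N : Set U) := by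
      have hc : Continuous (Subgroup.inclusion hUU') := by
        rw [continuous_induced_rng]
        exact continuous_subtype_val
      exact hNo.preimage hc
    haveI hNn' : N.Normal := Subgroup.normal_comap _
    have hNS' : IsSigmaInteger Sigma N.index := by
      refine hNS.of_dvd ?_
      rw [Subgroup.index_comap N''.1 (Subgroup.inclusion hUU')]
      exact Subgroup.relIndex_dvd_index_of_normal N''.1 (Subgroup.inclusion hUU').range
    have hker : fU.ker ≤ N := hU.ker_le N hNn' hNo' hNS'
    have : (⟨u, hu⟩ : U) ∈ N := hker (by rw [MonoidHom.mem_ker]; exact h)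
    exact Subgroup.mem_comap.mp this
  rwa [MonoidHom.mem_ker] at hmem

end Literature.AnabelianGeometry.SemiGraphs.SemiGraphOfAnabelioids.IsProSigmaCompletion

end
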